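import Summits.BirchSwinnertonDyer.Rank1Residual.X11b.TransvectionOfRam
import HarnessLib

/-!
# `Irr ∧ Ram` ⟹ `E(K)[p] = 0` for every quadratic field `K` (`p` odd)

HONEST FRAMING (cell `b2b-bsdres`, run/shared/lean/b2b/bsd-rank1-residual/, verbatim in every
file): the goal of the cell is to DELETE the COMBINATION-SHAPED residual classes of the
Birch–Swinnerton-Dyer formula for ALL analytic-rank `≤ 1` elliptic curves over `ℚ` — "full BSD
formula for every rank `≤ 1` curve in class `C`" assembled STRICTLY from published theorems — so
that the rank-`≤ 1` remainder becomes exactly the CONSTRUCTION-SHAPED classes, which are TYPED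
(missing-input `Prop`s), NOT attempted. This is not "finishing BSD". Sub-cell
`b2b-bsdres-multr1-p1` (X11b, route R1); no claim beyond the stated class; X11b stays
CONSTRUCTION-SHAPED; nothing here changes a label; no named fact (theorems only; no `sorry`).

A corollary of the bridge `TransvectionOfRam.lean` (`Irr ∧ Ram`, `p ≠ 2` ⟹ `E[p]|_{Γ_K}`
absolutely irreducible for every quadratic `K`): **the Mordell–Weil group of `E` over any quadratic
field `K` has no point of order `p`** — `E(K)[p] ↪ E[p]^{Γ_K}`, and an irreducible `Γ_K`-module of
dimension `2` has no non-zero fixed vector (a fixed vector spans a stable line). In the kernel: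
a `K`-point `P` killed by `p` is pushed into `E(ℚ̄)` along an embedding `K ≅ K' ⊂ ℚ̄` whose fixing
group is the image of `Γ_K → Γ_ℚ` (tree `Automorphic.exists_range_absGaloisRestrict_eq_fixingSubgroup`);
its frame coordinates `v = e(P̄)` are fixed by `ρ̄(Γ_K)`, so `𝔽_p · v` is a subrepresentation of
`ρ̄|_{Γ_K}`, which is irreducible; hence `v = 0`, `P = O`.

* `torsion_eq_zero_of_irr_of_ram` — for `W/ℚ` elliptic and globally minimal, `p ≠ 2` prime with
  `Irr W p` and `Ram W p`, `K ⊇ ℚ` a number field with `[K:ℚ] = 2`, and `P ∈ E(K)` with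
  `p • P = O`: `P = O`;
* `ChainLocus.torsion_eq_zero_quadratic` — the same on route R1's locus.

Where this is consumed (bookkeeping): the hypothesis "`E(K)[p] = 0`" / "`p ∤ #E(K)_tors`" of the
Heegner-point computations over the auxiliary imaginary quadratic field (Gross–Zagier index
bookkeeping, [JSW17] §7.4, [BCGS26] (tor)), and the residual form of the erratum's Lemma 2.1
hypothesis "`H⁰(K, A_g[ϖ]) = 0`" for `g = f_E` (`A_f[ϖ] ≅ E[p]`): on `ChainLocus` they follow from
the class predicate. [cite: Castella2018Erratum, Lemma 2.1 (hypotheses) and footnote 1 (p. 4)]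

References: [Serre1972] §2.8; [SilvermanAEC2009] III.§7, VIII.§1; [Castella2018Erratum] Lemma 2.1.
-/

noncomputable section

open scoped Classical Matrix

namespace Summit.BirchSwinnertonDyer.Rank1Residual.X11b.Transvection

open WeierstrassCurve Field Literature.NumberTheory.EllipticCurves
  Literature.NumberTheory.GaloisRepresentations Literature.NumberTheory.EllipticCurves.Rank1Residual

/-! ### A `K`-rational torsion point gives a `Gal(F̄/K)`-fixed geometric torsion point -/

/-- Over any base field `F`: a non-zero `K`-rational point `P` of `W` killed by `n`, `K/F` finite,
gives a non-zero point of `E(F̄)[n]` fixed by the image of `Γ_K → Γ_F` — push `P` along an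
embedding `K ≅ K' ⊂ F̄` whose fixing group is that image (tree
`Automorphic.exists_range_absGaloisRestrict_eq_fixingSubgroup`). Stated over a general `F` so that
`F̄ = AlgebraicClosure F` carries its own `F`-algebra structure throughout. [cite: SilvermanAEC2009, VIII.§1 (Galois action on points)] -/
theorem exists_fixed_geomTorsion_of_point {F : Type} [Field F] (W : WeierstrassCurve F)
    (K : Type) [Field K] [Algebra F K] [FiniteDimensional F K] {n : ℤ}
    (P : (W.baseChange K).toAffine.Point) (hP : n • P = 0) (hP0 : P ≠ 0) :
    ∃ Q : geomTorsion W n, Q ≠ 0 ∧ ∀ σ ∈ (absGaloisRestrict F K).range, σ • Q = Q := by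
  obtain ⟨K', ⟨eK⟩, hrange⟩ :=
    Literature.NumberTheory.Automorphic.exists_range_absGaloisRestrict_eq_fixingSubgroup F K
  let ι : K →ₐ[F] AlgebraicClosure F := (K'.val).comp eK.toAlgHom
  have hιK' : ∀ x : K, ι x ∈ K' := fun x => by
    change ((eK x : K') : AlgebraicClosure F) ∈ K'
    exact (eK x).2
  let Pbar : geomPoints W := Affine.Point.map ι P
  have hPbar0 : Pbar ≠ 0 := by
    intro h
    apply hP0
    apply Affine.Point.map_injective ι
    change Pbar = Affine.Point.map ι 0
    rw [h, map_zero]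
    rfl
  have hPbar_tors : Pbar ∈ geomTorsion W n := by
    change n • Affine.Point.map ι P = 0
    rw [← map_zsmul, hP, map_zero]
  refine ⟨⟨Pbar, hPbar_tors⟩, fun h => hPbar0 (congrArg Subtype.val h), fun σ hσ => ?_⟩
  apply Subtype.ext
  rw [Literature.NumberTheory.EllipticCurves.AddSubgroup.torsionBy.coe_smul]
  rw [hrange] at hσ
  have hσx : ∀ x : K, (show AlgebraicClosure F ≃ₐ[F] AlgebraicClosure F from σ) (ι x) = ι x :=
    fun x => (IntermediateField.mem_fixingSubgroup_iff _ _).mp hσ (ι x) (hιK' x)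
  have hcomp : ((show AlgebraicClosure F ≃ₐ[F] AlgebraicClosure F from σ) :
      AlgebraicClosure F →ₐ[F] AlgebraicClosure F).comp ι = ι := AlgHom.ext hσx
  change Affine.Point.map ((show AlgebraicClosure F ≃ₐ[F] AlgebraicClosure F from σ) :
      AlgebraicClosure F →ₐ[F] AlgebraicClosure F) (Affine.Point.map ι P) = Affine.Point.map ι P
  rw [Affine.Point.map_map, hcomp]

variable (W : WeierstrassCurve ℚ) [W.IsElliptic] [W.IsGloballyMinimal] (p : ℕ) [Fact p.Prime]

/-- **`Irr ∧ Ram`, `p ≠ 2` ⟹ `E(K)[p] = 0` for every quadratic field `K`.** For `W/ℚ` elliptic and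
globally minimal, a prime `p ≠ 2` with `E[p]` irreducible (`Irr W p`) and ramified at a
multiplicative prime (`Ram W p`), and a field `K ⊇ ℚ` with `[K:ℚ] = 2`: a `K`-rational point `P`
with `p • P = O` is `O`. Proof: `E[p]|_{Γ_K}` is (absolutely) irreducible
(`isAbsolutelyIrreducible_restrictField_of_irr_of_ram`); the image of `P` in `E(ℚ̄)[p]` is fixed
by the image of `Γ_K` (`exists_fixed_geomTorsion_of_point`), so its frame vector spans a
`Γ_K`-stable line unless it is zero. [cite: Serre1972, §2.8] [cite: SilvermanAEC2009, VIII.§1 (Galois action on points)] -/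
theorem torsion_eq_zero_of_irr_of_ram (hp2 : p ≠ 2) (hirr : Irr W p) (hram : Ram W p)
    (K : Type) [Field K] [NumberField K] (hK : Module.finrank ℚ K = 2)
    (P : (W.baseChange K).toAffine.Point) (hP : (p : ℤ) • P = 0) : P = 0 := by
  by_contra hP0
  have hp : p.Prime := Fact.out
  haveI : NeZero ((p : ℕ) : ℚ) := ⟨by exact_mod_cast hp.ne_zero⟩
  obtain ⟨ρ, hρ⟩ := W.exists_isTorsionGaloisRep p
  have hirrK : FramedRep.IsIrreducible (FramedGaloisRep.restrictField K ρ) :=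
    (isAbsolutelyIrreducible_restrictField_of_irr_of_ram W p hp2 hirr hram hρ K hK).isIrreducible
  obtain ⟨e, he⟩ := hρ
  obtain ⟨Q, hQ0, hfix⟩ := exists_fixed_geomTorsion_of_point W K P hP hP0
  -- the frame vector of `Q` is fixed by `ρ̄(Γ_K)`
  set v : Fin 2 → ZMod p := e Q with hv
  have hv0 : v ≠ 0 := by
    intro h
    apply hQ0
    apply e.injective
    rw [← hv, h, map_zero]
  have hvfix : ∀ τ : absoluteGaloisGroup K,
      ((ρ (absGaloisRestrict ℚ K τ) : GL (Fin 2) (ZMod p)) : Matrix (Fin 2) (Fin 2) (ZMod p)) *ᵥ v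
        = v := by
    intro τ
    have hmem : (absGaloisRestrict ℚ K) τ ∈ (absGaloisRestrict ℚ K).range := ⟨τ, rfl⟩
    rw [hv, ← he (absGaloisRestrict ℚ K τ) Q, hfix _ hmem]
  -- the stable line `𝔽_p · v` inside `ρ̄|_{Γ_K}`
  let π := (FramedGaloisRep.restrictField K ρ).toRepresentation
  have hπv : ∀ τ : absoluteGaloisGroup K, π τ v = v := fun τ => by
    change (FramedRep.toRepresentation (FramedGaloisRep.restrictField K ρ)) τ v = v
    rw [FramedRep.toRepresentation_apply_apply, FramedGaloisRep.restrictField_apply]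
    exact hvfix τ
  let L : Subrepresentation π :=
    ⟨Submodule.span (ZMod p) {v}, fun τ w hw => by
      obtain ⟨c, rfl⟩ := Submodule.mem_span_singleton.mp hw
      rw [map_smul, hπv τ]
      exact Submodule.smul_mem _ c (Submodule.mem_span_singleton_self v)⟩
  haveI := hirrK
  rcases IsSimpleOrder.eq_bot_or_eq_top L with h | h
  · have hbot : Submodule.span (ZMod p) ({v} : Set (Fin 2 → ZMod p)) = ⊥ :=
      congrArg Subrepresentation.toSubmodule h
    exact hv0 (Submodule.span_singleton_eq_bot.mp hbot)
  · have htop : Submodule.span (ZMod p) ({v} : Set (Fin 2 → ZMod p)) = ⊤ :=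
      congrArg Subrepresentation.toSubmodule h
    have h1 : Module.finrank (ZMod p) (Submodule.span (ZMod p) ({v} : Set (Fin 2 → ZMod p))) = 1 :=
      finrank_span_singleton hv0
    rw [htop, finrank_top, Module.finrank_fin_fun] at h1
    exact absurd h1 (by norm_num)

end Summit.BirchSwinnertonDyer.Rank1Residual.X11b.Transvection

namespace Summit.BirchSwinnertonDyer.Rank1Residual.X11b

open WeierstrassCurve

/-- **On `ChainLocus`, `E(K)[p] = 0` for every quadratic field `K`** (route R1's locus contains
`5 ≤ p`, `Irr W p`, and gives `Ram W p`): the "`p ∤ #E(K)_tors`" / "`E(K)[p] = 0`" side condition of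
the Heegner-point bookkeeping over the auxiliary imaginary quadratic field, from the class
predicate alone. [cite: Castella2018Erratum, Lemma 2.1 (hypotheses) and footnote 1 (p. 4)] -/
theorem ChainLocus.torsion_eq_zero_quadratic {W : WeierstrassCurve ℚ} [W.IsElliptic]
    [W.IsGloballyMinimal] {p : ℕ} [Fact p.Prime] (h : ChainLocus W p)
    (K : Type) [Field K] [NumberField K] (hK : Module.finrank ℚ K = 2)
    (P : (W.baseChange K).toAffine.Point) (hP : (p : ℤ) • P = 0) : P = 0 :=
  Transvection.torsion_eq_zero_of_irr_of_ram W p (by have := h.1; omega) h.2.2.1 h.ram K hK P hP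

end Summit.BirchSwinnertonDyer.Rank1Residual.X11b

end
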